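import Literature.MathematicalPhysics.QuantumFieldTheory.ConformalBootstrap3D.PointKernelK34L505Data
import Literature.MathematicalPhysics.QuantumFieldTheory.ConformalBootstrap3D.PointKernelK34L505Segs
import Literature.MathematicalPhysics.QuantumFieldTheory.ConformalBootstrap3D.PointKernelParts

/-!
# K34L505 certificate, kernel part file P13: one-cell head segments 60, 61 in level ranges

The head cells whose kernel evaluation exceeds one `decide` are one-cell segments of `hsegsK34L505`; each is
checked by `PCert.hPartSideOK` (side conditions) and `PCert.hPartOK` per level range `[n_lo, n_lo + count)`
against an integer claim, the claims summing to `≥ 0` (`PointKernel.partsOK`); soundness is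
`PCert.hParts_sound` (`PointKernelParts`).  The part files are mutually independent (each imports only
the data file); the ranges of one cell may span several of them, and the per-cell conclusions
`hparts_i` / `hcell_i` of those cells are assembled in `PointKernelK34L505.lean`.
Estimated kernel time 241 s.
-/

set_option maxRecDepth 100000
set_option maxHeartbeats 0

namespace Literature.MathematicalPhysics.QuantumFieldTheory.ConformalBootstrap3D.PointKernelK34L505

open Literature.MathematicalPhysics.QuantumFieldTheory.ConformalBootstrap3D.PointKernel

/-- levels `[31, 43)` of segment 60: partial lower sum `≥` claim. [folklore] -/
theorem part_60_1 : certK34L505.hPartOK (PCert.segAt hsegsK34L505 60) JHK34L505 31 12 (1451359103767699666011955038889429637) = true := by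
  decide +kernel

/-- levels `[43, 52)` of segment 60: partial lower sum `≥` claim. [folklore] -/
theorem part_60_2 : certK34L505.hPartOK (PCert.segAt hsegsK34L505 60) JHK34L505 43 9 (322517724848650324926505653637100693) = true := by
  decide +kernel

/-- levels `[52, 59)` of segment 60: partial lower sum `≥` claim. [folklore] -/
theorem part_60_3 : certK34L505.hPartOK (PCert.segAt hsegsK34L505 60) JHK34L505 52 7 (78360054807365479964294342018362649) = true := by
  decide +kernel

/-- one-cell segment 61 (row 4, cell `[5123/1024, 1281/256]`, chord, `n_F = 50`,
3 level ranges): side conditions. [folklore] -/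
theorem pside_61 : certK34L505.hPartSideOK (PCert.segAt hsegsK34L505 61) JHK34L505 = true := by
  decide +kernel

/-- its level ranges `(n_lo, count, claim)`. [folklore] -/
def partsK34L505_61 : List (ℕ × ℕ × ℤ) := [(0, 32, -1502687813537008257968500502098503168), (32, 13, 1341388292277799608190693477696158874), (45, 6, 161299521259208649777807024402344294)]

/-- the ranges tile `[0, n_F]` and the claims sum to `≥ 0`. [folklore] -/
theorem pcov_61 : PointKernel.partsOK 50 partsK34L505_61 = true := by
  decide +kernel

/-- levels `[0, 32)` of segment 61: partial lower sum `≥` claim. [folklore] -/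
theorem part_61_0 : certK34L505.hPartOK (PCert.segAt hsegsK34L505 61) JHK34L505 0 32 (-1502687813537008257968500502098503168) = true := by
  decide +kernel

end Literature.MathematicalPhysics.QuantumFieldTheory.ConformalBootstrap3D.PointKernelK34L505
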